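import Summits.Ventures.HodgeRepro2.T7SupportOneVectorBound

/-!
# The second-torus projector: `Φ_q(γ) = ⟪v, τ(γh) P_q τ(h⁻¹) v⟫` and `Φ_q(1) = ‖P_q τ(h⁻¹) v‖²` (support, seat p1)

t7-crit-1's formula (STATUS l. 15169) and memo v13's rewritten §2g (5) (l. 15190): the one-vector Fourier coefficient
`Φ_q(γ) = ∫_K conj(w^q) ⟪v, τ(γ h ρ_B(w) h⁻¹) v⟫ dw` of `T7SupportOneVectorOrbital` is the matrix coefficient
`⟪v, τ(γ h) P_q τ(h⁻¹) v⟫` of the PROJECTION `P_q = ∫_K conj(w^q) τ(ρ_B(w)) dw` onto the `(T_B, q)`-weight space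
(`T_B = h ρ_B h⁻¹`), and at `γ = 1` it is `‖P_q τ(h⁻¹) v‖² ≥ 0`, so the archimedean `(b′)` hypothesis per place,
`hq_v : Φ_q(1) ≠ 0`, is exactly «`τ(h⁻¹) v` has a non-zero `(ρ_B, q)`-component». This file proves both over an arbitrary
group `G`, a unitary `τ` on a COMPLETE inner product space `V` (the Bochner integral needs completeness) and a torus
`ρ_B : Circle →* G` along which `τ` is strongly continuous at the vectors in play:

* `torusProj τ ρB q x := ∫_K conj(w^q) • τ(ρ_B(w)) x dw` (`torusProj`); on a `ρ_B`-weight vector of weight `b` it is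
  `[q = b] • x` (`torusProj_weightVector`);
* **`fourierCoeff_eq_inner_torusProj`**: `Φ_q(γ) = ⟪v, τ(γ h) (P_q (τ(h⁻¹) v))⟫` (`integral_inner` + the continuous
  linear map `τ(γh)` through the integral);
* **`inner_torusProj_self`**: `⟪x, P_q x⟫ = ‖P_q x‖²` — by `⟪P_q x, P_q x⟫ = ∫∫ w^q conj(w'^q) ⟪τ(ρ_B w) x, τ(ρ_B w') x⟫`,
  unitarity, the left invariance of the Haar measure of the circle and the character identity `a(w w') = a(w) a(w')`
  (no Fubini: two applications of `integral_inner`);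
* **`fourierCoeff_one_eq_norm_sq`**: `Φ_q(1) = ‖P_q τ(h⁻¹) v‖²`, hence **`fourierCoeff_one_ne_zero_iff`**:
  `Φ_q(1) ≠ 0 ↔ P_q (τ(h⁻¹) v) ≠ 0` — the memo's «`hq_v ⟺ Φ_q(1) = ‖P_q π⁰(h⁻¹) u_A‖² ≠ 0`», and `Φ_q(1)` is a
  non-negative real (`fourierCoeff_one_nonneg`).

Nothing here is about any specific group, the adelic group, or any period.
Blind lane: Mathlib + the HodgeRepro2 prefix only; no sorry; axioms ⊆ {propext, Classical.choice, Quot.sound}.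
-/

namespace Summit.Ventures.HodgeRepro2.T7SupportTorusProjector

open MeasureTheory
open scoped InnerProductSpace
open T5HaarCircle T7SupportWeightTorusOrbital T7SupportOneVectorOrbital T7SupportOneVectorBound

variable {G : Type*} [Group G] {V : Type*} [NormedAddCommGroup V] [InnerProductSpace ℂ V]

/-- a unitary operator as a continuous linear map (norm-preserving, hence bounded by `1`) -/
noncomputable def unitaryCLM {τ : G →* (V →ₗ[ℂ] V)} (hτ : IsUnitaryRep τ) (g : G) : V →L[ℂ] V :=
  LinearMap.mkContinuous (τ g) 1 (fun x => by rw [norm_apply_eq hτ, one_mul])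

/-- `unitaryCLM hτ g` is `τ g` -/
@[simp]
theorem unitaryCLM_apply {τ : G →* (V →ₗ[ℂ] V)} (hτ : IsUnitaryRep τ) (g : G) (x : V) :
    unitaryCLM hτ g x = τ g x := rfl

/-- the character `w ↦ conj(w^q)` of the circle -/
theorem conj_zpow_mul (w w' : Circle) (q : ℤ) :
    (starRingEnd ℂ) (((w * w' : Circle) : ℂ) ^ q) = (starRingEnd ℂ) ((w : ℂ) ^ q) * (starRingEnd ℂ) ((w' : ℂ) ^ q) := by
  rw [Circle.coe_mul, mul_zpow, map_mul]

/-- `conj(w^q) = (w^q)⁻¹` on the circle -/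
theorem conj_zpow_eq_inv (w : Circle) (q : ℤ) : (starRingEnd ℂ) ((w : ℂ) ^ q) = ((w : ℂ) ^ q)⁻¹ := by
  rw [map_zpow₀, ← Circle.coe_inv_eq_conj, Circle.coe_inv, inv_zpow]

/-- `conj(w^q) · w^q = 1` on the circle -/
theorem conj_zpow_mul_zpow (w : Circle) (q : ℤ) : (starRingEnd ℂ) ((w : ℂ) ^ q) * (w : ℂ) ^ q = 1 := by
  rw [conj_zpow_eq_inv]
  exact inv_mul_cancel₀ (zpow_ne_zero q (Circle.coe_ne_zero w))

/-- the integrand of `P_q x` is continuous when `w ↦ τ(ρ_B(w)) x` is -/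
theorem continuous_integrand (τ : G →* (V →ₗ[ℂ] V)) (ρB : Circle →* G) (q : ℤ) {x : V}
    (hx : Continuous fun w : Circle => τ (ρB w) x) :
    Continuous fun w : Circle => (starRingEnd ℂ) ((w : ℂ) ^ q) • τ (ρB w) x :=
  (Complex.continuous_conj.comp ((continuous_subtype_val).zpow₀ q fun w => Or.inl (Circle.coe_ne_zero w))).smul hx

variable [MeasurableSpace Circle] [BorelSpace Circle] [CompleteSpace V]

/-- **the projector onto the `(ρ_B, q)`-weight space**: `P_q x = ∫_K conj(w^q) • τ(ρ_B(w)) x dw` -/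
noncomputable def torusProj (τ : G →* (V →ₗ[ℂ] V)) (ρB : Circle →* G) (q : ℤ) (x : V) : V :=
  ∫ w : Circle, (starRingEnd ℂ) ((w : ℂ) ^ q) • τ (ρB w) x ∂haarCircle

/-- a continuous function on the circle is integrable for the Haar probability measure -/
theorem integrable_of_continuous {E : Type*} [NormedAddCommGroup E] {f : Circle → E} (hf : Continuous f) :
    Integrable f (haarCircle : Measure Circle) :=
  hf.integrable_of_hasCompactSupport (HasCompactSupport.of_compactSpace f)

/-- **on a weight vector of weight `b`, `P_q x = [q = b] • x`** -/
theorem torusProj_weightVector {τ : G →* (V →ₗ[ℂ] V)} {ρB : Circle →* G} {b : ℤ} {x : V}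
    (hx : IsWeightVector τ ρB b x) (q : ℤ) :
    torusProj τ ρB q x = (if b = q then (1 : ℂ) else 0) • x := by
  unfold torusProj
  have e : ∀ w : Circle, (starRingEnd ℂ) ((w : ℂ) ^ q) • τ (ρB w) x =
      ((w : ℂ) ^ b * (starRingEnd ℂ) ((w : ℂ) ^ q)) • x := by
    intro w
    rw [hx w, smul_smul, mul_comm]
  simp_rw [e]
  rw [integral_smul_const, integral_zpow_mul_conj_zpow]

/-- **`Φ_q(γ) = ⟪v, τ(γ h) (P_q (τ(h⁻¹) v))⟫`** -/
theorem fourierCoeff_eq_inner_torusProj {τ : G →* (V →ₗ[ℂ] V)} (hτ : IsUnitaryRep τ) (v : V) (h : G)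
    (ρB : Circle →* G) (q : ℤ) (γ : G) (hx : Continuous fun w : Circle => τ (ρB w) (τ h⁻¹ v)) :
    T7SupportOneVectorOrbital.fourierCoeff τ v h ρB q γ = ⟪v, τ (γ * h) (torusProj τ ρB q (τ h⁻¹ v))⟫_ℂ := by
  unfold T7SupportOneVectorOrbital.fourierCoeff torusProj
  have hint := integrable_of_continuous (continuous_integrand τ ρB q hx)
  have e : ∀ w : Circle, (starRingEnd ℂ) ((w : ℂ) ^ q) * coeff τ v v (γ * (h * ρB w * h⁻¹)) =
      ⟪v, unitaryCLM hτ (γ * h) ((starRingEnd ℂ) ((w : ℂ) ^ q) • τ (ρB w) (τ h⁻¹ v))⟫_ℂ := by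
    intro w
    rw [unitaryCLM_apply, map_smul, inner_smul_right]
    congr 1
    unfold coeff
    congr 1
    rw [show γ * (h * ρB w * h⁻¹) = (γ * h) * ρB w * h⁻¹ by group, map_mul, map_mul, Module.End.mul_apply,
      Module.End.mul_apply]
  have hint2 : Integrable (fun w : Circle =>
      unitaryCLM hτ (γ * h) ((starRingEnd ℂ) ((w : ℂ) ^ q) • τ (ρB w) (τ h⁻¹ v))) (haarCircle : Measure Circle) :=
    (unitaryCLM hτ (γ * h)).integrable_comp hint
  rw [← unitaryCLM_apply hτ (γ * h), ← ContinuousLinearMap.integral_comp_comm _ hint, ← integral_inner hint2]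
  exact integral_congr_ae (Filter.Eventually.of_forall e)

omit [BorelSpace Circle] in
/-- `⟪∫ f, c⟫ = ∫ ⟪f w, c⟫` (the conjugate of `integral_inner`) -/
theorem inner_integral_left {f : Circle → V} (hf : Integrable f (haarCircle : Measure Circle)) (c : V) :
    ⟪∫ w, f w ∂haarCircle, c⟫_ℂ = ∫ w, ⟪f w, c⟫_ℂ ∂haarCircle := by
  rw [← inner_conj_symm, ← integral_inner hf, ← integral_conj]
  congr 1
  funext w
  rw [inner_conj_symm]

/-- `⟪τ(ρ_B(w)) x, P_q x⟫ = conj(w^q) ⟪x, P_q x⟫` (unitarity + left invariance of the Haar measure) -/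
theorem inner_apply_torusProj {τ : G →* (V →ₗ[ℂ] V)} (hτ : IsUnitaryRep τ) (ρB : Circle →* G) (q : ℤ) {x : V}
    (hx : Continuous fun w : Circle => τ (ρB w) x) (w : Circle) :
    ⟪τ (ρB w) x, torusProj τ ρB q x⟫_ℂ = (starRingEnd ℂ) ((w : ℂ) ^ q) * ⟪x, torusProj τ ρB q x⟫_ℂ := by
  have hint := integrable_of_continuous (continuous_integrand τ ρB q hx)
  unfold torusProj
  rw [← integral_inner hint, ← integral_inner hint]
  set F : Circle → ℂ := fun u => (starRingEnd ℂ) (((w * u : Circle) : ℂ) ^ q) * ⟪x, τ (ρB u) x⟫_ℂ with hF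
  have e : ∀ w' : Circle, ⟪τ (ρB w) x, (starRingEnd ℂ) ((w' : ℂ) ^ q) • τ (ρB w') x⟫_ℂ = F (w⁻¹ * w') := by
    intro w'
    rw [hF]
    simp only
    rw [mul_inv_cancel_left, inner_smul_right]
    congr 1
    have h1 := inner_apply_eq_inner_inv hτ (ρB w)⁻¹ (τ (ρB w') x) x
    rw [inv_inv] at h1
    rw [← h1, ← map_inv, ← Module.End.mul_apply, ← map_mul, map_mul ρB, map_inv ρB]
  simp_rw [e]
  rw [integral_mul_left_eq_self F w⁻¹, hF]
  simp_rw [conj_zpow_mul, mul_assoc, inner_smul_right]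
  rw [integral_const_mul]

/-- **`⟪x, P_q x⟫ = ⟪P_q x, P_q x⟫`** -/
theorem inner_torusProj_self {τ : G →* (V →ₗ[ℂ] V)} (hτ : IsUnitaryRep τ) (ρB : Circle →* G) (q : ℤ) {x : V}
    (hx : Continuous fun w : Circle => τ (ρB w) x) :
    ⟪x, torusProj τ ρB q x⟫_ℂ = ⟪torusProj τ ρB q x, torusProj τ ρB q x⟫_ℂ := by
  have hint := integrable_of_continuous (continuous_integrand τ ρB q hx)
  have e1 : ⟪torusProj τ ρB q x, torusProj τ ρB q x⟫_ℂ =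
      ∫ w : Circle, ⟪(starRingEnd ℂ) ((w : ℂ) ^ q) • τ (ρB w) x, torusProj τ ρB q x⟫_ℂ ∂haarCircle :=
    inner_integral_left hint _
  rw [e1]
  have key : ∀ w : Circle,
      ⟪(starRingEnd ℂ) ((w : ℂ) ^ q) • τ (ρB w) x, torusProj τ ρB q x⟫_ℂ = ⟪x, torusProj τ ρB q x⟫_ℂ := by
    intro w
    rw [inner_smul_left, Complex.conj_conj, inner_apply_torusProj hτ ρB q hx w, ← mul_assoc, mul_comm ((w : ℂ) ^ q),
      conj_zpow_mul_zpow, one_mul]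
  simp_rw [key]
  rw [integral_const, probReal_univ, one_smul]

/-- **`⟪x, P_q x⟫ = ‖P_q x‖²`** -/
theorem inner_torusProj_self_eq_norm_sq {τ : G →* (V →ₗ[ℂ] V)} (hτ : IsUnitaryRep τ) (ρB : Circle →* G) (q : ℤ)
    {x : V} (hx : Continuous fun w : Circle => τ (ρB w) x) :
    ⟪x, torusProj τ ρB q x⟫_ℂ = ((‖torusProj τ ρB q x‖ : ℝ) : ℂ) ^ 2 := by
  rw [inner_torusProj_self hτ ρB q hx, inner_self_eq_norm_sq_to_K]
  rfl

/-- **`Φ_q(1) = ‖P_q τ(h⁻¹) v‖²`** -/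
theorem fourierCoeff_one_eq_norm_sq {τ : G →* (V →ₗ[ℂ] V)} (hτ : IsUnitaryRep τ) (v : V) (h : G)
    (ρB : Circle →* G) (q : ℤ) (hx : Continuous fun w : Circle => τ (ρB w) (τ h⁻¹ v)) :
    T7SupportOneVectorOrbital.fourierCoeff τ v h ρB q 1 = ((‖torusProj τ ρB q (τ h⁻¹ v)‖ : ℝ) : ℂ) ^ 2 := by
  rw [fourierCoeff_eq_inner_torusProj hτ v h ρB q 1 hx, one_mul, ← inner_torusProj_self_eq_norm_sq hτ ρB q hx,
    inner_apply_eq_inner_inv hτ h]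

/-- `Φ_q(1)` is a non-negative real -/
theorem fourierCoeff_one_nonneg {τ : G →* (V →ₗ[ℂ] V)} (hτ : IsUnitaryRep τ) (v : V) (h : G)
    (ρB : Circle →* G) (q : ℤ) (hx : Continuous fun w : Circle => τ (ρB w) (τ h⁻¹ v)) :
    0 ≤ (T7SupportOneVectorOrbital.fourierCoeff τ v h ρB q 1).re ∧
      (T7SupportOneVectorOrbital.fourierCoeff τ v h ρB q 1).im = 0 := by
  rw [fourierCoeff_one_eq_norm_sq hτ v h ρB q hx]
  constructor
  · rw [← Complex.ofReal_pow, Complex.ofReal_re]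
    positivity
  · rw [← Complex.ofReal_pow, Complex.ofReal_im]

/-- **`hq` IS «`τ(h⁻¹) v` has a non-zero `(ρ_B, q)`-component»**: `Φ_q(1) ≠ 0 ↔ P_q (τ(h⁻¹) v) ≠ 0` -/
theorem fourierCoeff_one_ne_zero_iff {τ : G →* (V →ₗ[ℂ] V)} (hτ : IsUnitaryRep τ) (v : V) (h : G)
    (ρB : Circle →* G) (q : ℤ) (hx : Continuous fun w : Circle => τ (ρB w) (τ h⁻¹ v)) :
    T7SupportOneVectorOrbital.fourierCoeff τ v h ρB q 1 ≠ 0 ↔ torusProj τ ρB q (τ h⁻¹ v) ≠ 0 := by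
  rw [fourierCoeff_one_eq_norm_sq hτ v h ρB q hx]
  simp [pow_eq_zero_iff, norm_eq_zero]

end Summit.Ventures.HodgeRepro2.T7SupportTorusProjector
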